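import Mathlib
import Literature.MathematicalPhysics.QuantumFieldTheory.Balaban1983to89.T3UnitScaleTilt
import Literature.MathematicalPhysics.QuantumFieldTheory.Balaban1983to89.T3UnitLawDensityEML
import HarnessLib

/-!
# LINE 30 «CurvaturePoincare» — stub `stub_sqrtPinnedTail` PROVED: square-root pinning + an exponential moment + a first moment
# ⟹ the centred upper tail (pure measure theory; no physics)

Seat `ym-line-cst-p1` (g33), `--supports stmt-QuantumFields-23532` (`PoincareLipschitz.MesoscopicConcentrationL`, K1′; skeleton
`Cruxes/HistoryTailL/Lines/curvature_poincare.lean` of ideator `ym-r3-idea-2` g16, registered 2026-08-29T19:26Z; stub named to this seat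
by the OWNER 19:27:18Z).  The theorem below is the registered stub TOKEN FOR TOKEN.  Under `μ_K = gibbsK F ℰp γ K` (a probability measure):
if a measurable `g` is pinned `|g − g₁| ≤ M·√X` to a bounded measurable `X ≥ 0` with `∫e^{tX} dμ_K ≤ e^A` and `∫X dμ_K ≤ m`, then for `r > 0`
with `4M²m ≤ r²`: `μ_K{r ≤ g − ∫g} ≤ e^A·exp(−t·r²/(4M²))`.

THE ARGUMENT.
1. CENTRING WITHOUT SQUARE ROOTS OF INTEGRALS: pointwise AM–GM `√x ≤ (x/a + a)/2` (`x ≥ 0`, `a > 0`) at `a = r/(2M)` (`M > 0`) gives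
   `|∫g − g₁| ≤ ∫|g − g₁| ≤ M·∫√X ≤ M·(m/a + a)/2 = M²m/r + r/4 ≤ r/2` (by `4M²m ≤ r²`).  (`M = 0`: `g ≡ g₁`, the event is empty.)
2. On `{r ≤ g − ∫g}`: `M√X ≥ |g − g₁| ≥ r − r/2`, so `X = (√X)² ≥ (r/(2M))² = r²/(4M²)`.
3. Exponential Chebyshev (Mathlib `ProbabilityTheory.measure_ge_le_exp_mul_mgf`; `e^{tX}` is bounded by `e^{t·Xmax}`, hence integrable):
   `μ_K{r²/(4M²) ≤ X} ≤ e^{−t·r²/(4M²)}·∫e^{tX} ≤ e^{−t·r²/(4M²)}·e^A`.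

HONEST SCOPE.  Bookkeeping only; nothing of the line's other stubs (`stub_curvaturePinning`, `stub_localBoxExpMoment`, the residual
`stub_moderateDeviationResidual`), of `MesoscopicConcentrationL` (23532), `HistoryTailL` (19936) or rung R3 (`YM3TorusSU2`, a RECORD rung —
not d = 4, not infinite volume, not a mass gap, not Clay) is proved here.

References: M. Ledoux, *The concentration of measure phenomenon*, AMS (2001), §1.1 [Ledoux2001]; Mathlib `measure_ge_le_exp_mul_mgf`.
-/

noncomputable section

namespace Summit.QuantumFields.YangMills.Theorems.PoincareLipschitzMesoscopicConcentrationLSqrtPinnedTail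

open MeasureTheory ProbabilityTheory Finset
open Literature.MathematicalPhysics.QuantumFieldTheory
open Literature.MathematicalPhysics.QuantumFieldTheory.Balaban1983to89
open Literature.MathematicalPhysics.QuantumFieldTheory.Balaban1983to89.T3ContinuumYM3Torus
open Literature.MathematicalPhysics.QuantumFieldTheory.Balaban1983to89.T3UnitScaleTilt
open Literature.MathematicalPhysics.QuantumFieldTheory.Balaban1983to89.T3UnitLawDensityEML (ℰp)

/-! ## §1 AM–GM for the square root -/

/-- `√x ≤ (x/a + a)/2` for `x ≥ 0`, `a > 0` (from `(√x − a)² ≥ 0`). [folklore] -/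
theorem sqrt_le_amgm {x a : ℝ} (hx : 0 ≤ x) (ha : 0 < a) : Real.sqrt x ≤ (x / a + a) / 2 := by
  have hsq : Real.sqrt x ^ 2 = x := Real.sq_sqrt hx
  have h0 : 0 ≤ (Real.sqrt x - a) ^ 2 := sq_nonneg _
  rw [le_div_iff₀ (by norm_num : (0 : ℝ) < 2), div_add' _ _ _ ha.ne', le_div_iff₀ ha]
  nlinarith [hsq, h0]

/-! ## §2 The registered stub BY NAME AND SIGNATURE -/

/-- **stub_sqrtPinnedTail (LINE 30 «CurvaturePoincare»), PROVED — token-identical with the registered stub of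
`Cruxes/HistoryTailL/Lines/curvature_poincare.lean` (crux stmt-QuantumFields-23532).**  Under `μ_K = gibbsK` (probability): if measurable `g` is
pinned `|g − g₁| ≤ M·√X` to a bounded measurable `X ≥ 0` with `∫e^{tX} ≤ e^A` and `∫X ≤ m`, then for `r > 0`, `r² ≥ 4M²m`:
`μ_K{r ≤ g − ∫g} ≤ e^A·exp(−t·r²/(4M²))`.  Proof: centring by the pointwise AM–GM `√X ≤ (X/a + a)/2` at `a = r/(2M)` (`|∫g − g₁| ≤ M²m/r + r/4 ≤ r/2`),
the event lies in `{r²/(4M²) ≤ X}`, exponential Chebyshev (`measure_ge_le_exp_mul_mgf`); `M = 0` ⇒ `g ≡ g₁`, empty event. [cite: Ledoux2001, §1.1] -/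
theorem stub_sqrtPinnedTail :
    ∀ (F : T3Family) (γ : ℝ), 0 < γ → ∀ (K : ℕ) (X g : GaugeField (F.P K) 0 (Matrix.specialUnitaryGroup (Fin 2) ℂ) → ℝ) (g₁ M t A m Xmax : ℝ),
      Measurable g → Measurable X → 0 ≤ M → 0 < t → 0 ≤ m → (∀ U, 0 ≤ X U) → (∀ U, X U ≤ Xmax) →
      (∀ U, |g U - g₁| ≤ M * Real.sqrt (X U)) →
      ∫ U, Real.exp (t * X U) ∂(gibbsK F ℰp γ K) ≤ Real.exp A →
      ∫ U, X U ∂(gibbsK F ℰp γ K) ≤ m →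
      ∀ r : ℝ, 0 < r → 4 * (M ^ 2 * m) ≤ r ^ 2 →
        (gibbsK F ℰp γ K).real {U | r ≤ g U - ∫ V, g V ∂(gibbsK F ℰp γ K)} ≤ Real.exp A * Real.exp (-(t * r ^ 2 / (4 * M ^ 2))) := by
  intro F γ hγ K X g g₁ M t A m Xmax hgm hXm hM ht hm hX0 hXmax hpin hexp hmean r hr hrM
  haveI := isProbabilityMeasure_gibbsK F ℰp hγ.le K
  set μ := gibbsK F ℰp γ K with hμ
  have hRHS0 : 0 ≤ Real.exp A * Real.exp (-(t * r ^ 2 / (4 * M ^ 2))) := by positivity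
  -- integrability of `X`, `√X`, `g`
  have hsqrt_le : ∀ U, Real.sqrt (X U) ≤ Real.sqrt Xmax := fun U => Real.sqrt_le_sqrt (hXmax U)
  have hXi : Integrable X μ :=
    (integrable_const Xmax).mono' hXm.aestronglyMeasurable
      (ae_of_all _ fun U => by rw [Real.norm_eq_abs, abs_of_nonneg (hX0 U)]; exact hXmax U)
  have hsqi : Integrable (fun U => Real.sqrt (X U)) μ :=
    (integrable_const (Real.sqrt Xmax)).mono' (Real.continuous_sqrt.measurable.comp hXm).aestronglyMeasurable
      (ae_of_all _ fun U => by rw [Real.norm_eq_abs, abs_of_nonneg (Real.sqrt_nonneg _)]; exact hsqrt_le U)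
  have hgb : ∀ U, |g U| ≤ |g₁| + M * Real.sqrt Xmax := fun U => by
    have h1 := abs_sub_abs_le_abs_sub (g U) g₁
    have h2 : |g U - g₁| ≤ M * Real.sqrt Xmax := (hpin U).trans (mul_le_mul_of_nonneg_left (hsqrt_le U) hM)
    linarith
  have hgi : Integrable g μ :=
    (integrable_const (|g₁| + M * Real.sqrt Xmax)).mono' hgm.aestronglyMeasurable
      (ae_of_all _ fun U => by rw [Real.norm_eq_abs]; exact hgb U)
  -- the case `M = 0`: `g ≡ g₁`, the event is empty
  rcases hM.eq_or_lt with hM0 | hMpos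
  · have hconst : ∀ U, g U = g₁ := fun U => by
      have := hpin U; rw [← hM0, zero_mul] at this
      exact sub_eq_zero.mp (abs_nonpos_iff.mp this)
    have hint : ∫ V, g V ∂μ = g₁ := by
      rw [show g = fun _ => g₁ from funext hconst, integral_const, smul_eq_mul, probReal_univ, one_mul]
    have hempty : {U | r ≤ g U - ∫ V, g V ∂μ} = ∅ := by
      ext U; simp only [Set.mem_setOf_eq, Set.mem_empty_iff_false, iff_false, not_le, hint, hconst U, sub_self]; exact hr
    rw [hempty, measureReal_empty]; exact hRHS0
  -- `M > 0`: centring by AM–GM at `a = r/(2M)`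
  have ha : 0 < r / (2 * M) := by positivity
  have hcen : |(∫ V, g V ∂μ) - g₁| ≤ r / 2 := by
    have h1 : (∫ V, g V ∂μ) - g₁ = ∫ V, (g V - g₁) ∂μ := by
      rw [integral_sub hgi (integrable_const _), integral_const, smul_eq_mul, probReal_univ, one_mul]
    rw [h1]
    have hami : Integrable (fun V => M * ((X V / (r / (2 * M)) + r / (2 * M)) / 2)) μ :=
      (((hXi.div_const _).add (integrable_const _)).div_const _).const_mul M
    calc |∫ V, (g V - g₁) ∂μ| ≤ ∫ V, |g V - g₁| ∂μ := abs_integral_le_integral_abs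
      _ ≤ ∫ V, M * ((X V / (r / (2 * M)) + r / (2 * M)) / 2) ∂μ := by
          refine integral_mono (hgi.sub (integrable_const _)).abs hami fun V => ?_
          exact (hpin V).trans (mul_le_mul_of_nonneg_left (sqrt_le_amgm (hX0 V) ha) hM)
      _ = M * (((∫ V, X V ∂μ) / (r / (2 * M)) + r / (2 * M)) / 2) := by
          rw [integral_const_mul, integral_div, integral_add (hXi.div_const _) (integrable_const _), integral_div,
            integral_const, smul_eq_mul, probReal_univ, one_mul]
      _ ≤ M * ((m / (r / (2 * M)) + r / (2 * M)) / 2) := by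
          gcongr
      _ = M ^ 2 * m / r + r / 4 := by field_simp; ring
      _ ≤ r / 2 := by
          have h4 : M ^ 2 * m / r ≤ r / 4 := by
            rw [div_le_iff₀ hr]; nlinarith
          linarith
  -- the event lies in `{r²/(4M²) ≤ X}`
  have hsub : {U | r ≤ g U - ∫ V, g V ∂μ} ⊆ {U | r ^ 2 / (4 * M ^ 2) ≤ X U} := by
    intro U hU
    simp only [Set.mem_setOf_eq] at hU ⊢
    have h2 := le_abs_self (g U - g₁)
    have h3 := neg_abs_le ((∫ V, g V ∂μ) - g₁)
    have hhalf : r / 2 ≤ M * Real.sqrt (X U) := by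
      have h1 : g U - ∫ V, g V ∂μ = (g U - g₁) - ((∫ V, g V ∂μ) - g₁) := by ring
      linarith [hpin U, h1 ▸ hU]
    have hsq0 : 0 ≤ Real.sqrt (X U) := Real.sqrt_nonneg _
    have hle : r / (2 * M) ≤ Real.sqrt (X U) := by
      rw [div_le_iff₀ (by positivity : (0 : ℝ) < 2 * M)]; linarith
    calc r ^ 2 / (4 * M ^ 2) = (r / (2 * M)) ^ 2 := by field_simp; ring
      _ ≤ Real.sqrt (X U) ^ 2 := pow_le_pow_left₀ ha.le hle 2
      _ = X U := Real.sq_sqrt (hX0 U)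
  -- exponential Chebyshev
  have hint : Integrable (fun U => Real.exp (t * X U)) μ :=
    (integrable_const (Real.exp (t * Xmax))).mono' (Real.measurable_exp.comp (hXm.const_mul t)).aestronglyMeasurable
      (ae_of_all _ fun U => by
        rw [Real.norm_eq_abs, abs_of_pos (Real.exp_pos _)]
        exact Real.exp_le_exp.mpr (mul_le_mul_of_nonneg_left (hXmax U) ht.le))
  have hmgf : mgf X μ t ≤ Real.exp A := by simp only [mgf]; exact hexp
  calc μ.real {U | r ≤ g U - ∫ V, g V ∂μ} ≤ μ.real {U | r ^ 2 / (4 * M ^ 2) ≤ X U} :=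
        measureReal_mono hsub (measure_ne_top _ _)
    _ ≤ Real.exp (-t * (r ^ 2 / (4 * M ^ 2))) * mgf X μ t := measure_ge_le_exp_mul_mgf _ ht.le hint
    _ ≤ Real.exp (-t * (r ^ 2 / (4 * M ^ 2))) * Real.exp A := mul_le_mul_of_nonneg_left hmgf (Real.exp_pos _).le
    _ = Real.exp A * Real.exp (-(t * r ^ 2 / (4 * M ^ 2))) := by
        rw [mul_comm]; congr 2; ring

end Summit.QuantumFields.YangMills.Theorems.PoincareLipschitzMesoscopicConcentrationLSqrtPinnedTail

end
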